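import Summits.QuantumFields.YangMills.Theorems.UnitScaleTiltProp7GaugeFixedRowDoorOfLODTarget
import HarnessLib

/-!
# Route `UnitScaleTilt`, crux K1 «MinimiserStabilityRegPr» (stmt-QuantumFields-19200), EX row `hGF` (curved member), LOD ∕ Combes–Thomas line —
# **THE TWO-REGIME γ-ROW DOOR: a curved target proved SEPARATELY on two classes of members (LARGE members — the (L6) LOD member assembly, which needs an
# admissible cube scale `s₀(L) < m + n`; SMALL members `m + n ≤ s₀(L)` — the toron ∕ twisted-Plancherel exit (α)(a), ★★OWNER WORDS 79∕82), each with ITS OWN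
# regularity cap, floor constant and coupling, IMPLIES the displayed gauge-fixed row `hGF[Lift]` of S44ᴸγ at the merged letters `αcap := min α₁ α₂`,
# `γ := min γ₁ γ₂` and the display's free coupling `a ≥ a₁, a₂`.**

Cell `ym3-torus` (HUMAN RULING D-0037, rung R3 — NOT d = 4, NOT infinite volume, NOT a mass gap, NOT Clay).  EX namer seat `ym-ust-19200-w2` (gen 12).  THEOREMS ONLY
(0 `def`, 0 `sorry`); `--supports stmt-QuantumFields-19200 --as helper`, count-neutral.  Bookkeeping over ★p1 g24's door ✓`Prop7GaugeFixedRowDoorOfLODTarget.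
gaugeFixedRow_idx_of_curvedTarget_of_le_coupling` (★★OWNER WORD 63, S45 shape (B)): `RegPr` is monotone in the radius (lit ✓`T3PrintedMinimiserExistence.regPr_mono`),
the target is monotone in the floor constant and in the coupling, and the member index splits by `by_cases`.  PURPOSE (namer): it FIXES IN THE TREE the two binder TEXTS
`hT₁` (large members — the output shape owed by px10 g11's `…Prop7LODAssemblyMember` + §2 window, read at `Large L i := s₀ L < i.1.1.m + i.1.2.1`) and `hT₂` (small
members — the target binder of the (α)(a) series P1–P3, read at `i.1.1.m + i.1.2.1 ≤ s₀ L`), so that each pen proves ITS text verbatim and the display event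
(S45′ := S44ᴸγ − [γ hγ hGF] + [whichever of hT₁ ∕ hT₂ is still open], OWNER's decision) is ONE `exact` by name.

WHAT IS PROVED (ns `…Theorems.Prop7GaugeFixedRowDoorTwoRegime`).
* ★★ `gaugeFixedRow_idx_of_curvedTargets_split` — abstract member predicate `Large : ∀ L, Idx L → Prop`; targets `hT₁` on `Large`, `hT₂` on `¬ Large`, at caps `α₁, α₂`,
  floors `γ₁, γ₂`, couplings `a₁, a₂ ≤ a`; window `10¹²L³·α₁ L ≤ 1` asked of ONE cap only (the merged cap is below it) ⟹ the `hGF` binder of S44ᴸγ VERBATIM at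
  `αcap := fun L => min (α₁ L) (α₂ L)`, `γ := fun L => min (γ₁ L) (γ₂ L)`.
* ★★ `gaugeFixedRow_idx_of_curvedTargets_cubeScale` — the same read at the cube-scale threshold `s₀ : ℕ → ℕ`: `hT₁` behind `s₀ L < i.1.1.m + i.1.2.1` (an admissible
  LOD cube scale exists, ✓`Prop7LODCutoffDock.exists_LOD_cutoffs_corner`'s `hs : s < F.m + n`), `hT₂` behind `i.1.1.m + i.1.2.1 ≤ s₀ L`.

HONEST SCOPE.  A door (case split + three monotonicities over landed theorems); NEITHER target is proved here; nothing of (3.49), Thm 3.3∕3.11, `h349`, `hGF`, EX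
`stub_existenceMinimalOrbit` or the crux is proved; no display event is claimed (1-for-1∕1-for-2 trades are not events — namer policy; the OWNER rules).
Rung R3 — NOT d = 4, NOT infinite volume, NOT a mass gap, NOT Clay.

References: T. Bałaban, CMP **99** (1985) 389–434 [Balaban1985BackgroundPropagators] ((3.1)–(3.2) p.390, Thm 3.3 p.398, Thm 3.11 p.416, (3.118)–(3.122) pp.419–420);
CMP **95** (1984) 17–40 [Balaban1984PropagatorsI] (Prop. 1.1 (1.90) p.33).
-/

set_option autoImplicit false

noncomputable section

open scoped InnerProductSpace ComplexConjugate Matrix.Norms.L2Operator BigOperators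

namespace Summit.QuantumFields.YangMills.Theorems.Prop7GaugeFixedRowDoorTwoRegime

open Literature.MathematicalPhysics.QuantumFieldTheory.Balaban1983to89
open Literature.MathematicalPhysics.QuantumFieldTheory.Balaban1983to89.T3ContinuumYM3Torus
open T4Continuum BlockAveraging
open BlockAveraging (Idx)
open B7Prop1Explicit (disp)
open B10Eq27TorusAxialLog (holT transl)
open B7TransferAnalyticMean (meanCLM)
open B11Eq103H1Complex (SiteL2K BondL2K projR)
open B15DeterminingSets (embIter)
open Summit.QuantumFields.YangMills.Theorems.Prop8Chart (emlIterU)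
open T3PrintedRegularMinimiser (RegPr)
open T3PrintedMinimiserExistence (regPr_mono)
open T3SectALandauChart (bgUnits)
open Summit.QuantumFields.YangMills.Theorems.Prop7SectET3Transport (periodsT3)
open Summit.QuantumFields.YangMills.Theorems.Prop7SectET3HilbertLetters (W₂ toL2S DL2 DstarL2 covLapSite)
open Summit.QuantumFields.YangMills.Theorems.Prop7SectET3GaugeProjector (NS RS)
open Summit.QuantumFields.YangMills.Theorems.Prop7SectET3WilsonHessian (DeltaEta)
open Summit.QuantumFields.YangMills.Theorems.Prop7SectET3CurvedPropagators (Qk)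
open Summit.QuantumFields.YangMills.Theorems.Prop7GaugeFixedRowDoorOfLODTarget (gaugeFixedRow_idx_of_curvedTarget_of_le_coupling)

/-! ## §1 Two member classes, two caps, two floors, two couplings -/

/-- ★★ **THE TWO-REGIME DOOR (abstract member predicate).**  If the curved target holds on the members `Large L i` at cap `α₁`, floor `γ₁`, coupling `a₁`, and on
the others at `α₂, γ₂, a₂`, with `a₁, a₂ ≤ a` and the print window `10¹²L³·α₁ L ≤ 1`, then the displayed row `hGF[Lift]` of S44ᴸγ holds at `αcap := min α₁ α₂`,
`γ := min γ₁ γ₂`, coupling `a` — `RegPr` monotone in the radius, the target monotone in floor and coupling, `by_cases` on the member.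
[cite: Balaban1985BackgroundPropagators, (3.1)–(3.2) p.390, Thm 3.3 p.398, Thm 3.11 p.416] -/
theorem gaugeFixedRow_idx_of_curvedTargets_split (α₁ α₂ : ℕ → ℝ) (hα₁ : ∀ L : ℕ, 1 < L → 0 < α₁ L) (hα₂ : ∀ L : ℕ, 1 < L → 0 < α₂ L)
    (hWα : ∀ L : ℕ, 1 < L → 10 ^ 12 * (L : ℝ) ^ 3 * α₁ L ≤ 1)
    (c₀ cB : ℕ → ℝ) [hc₀ : ∀ L : ℕ, Fact (0 < c₀ L)] [hcB : ∀ L : ℕ, Fact (0 < cB L)] (a₁ a₂ a : ∀ L : ℕ, T3Thm1Carrier.Idx L → ℝ)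
    (ha₁ : ∀ (L : ℕ) (i : T3Thm1Carrier.Idx L), a₁ L i ≤ a L i) (ha₂ : ∀ (L : ℕ) (i : T3Thm1Carrier.Idx L), a₂ L i ≤ a L i) (γ₁ γ₂ : ℕ → ℝ)
    (Large : ∀ L : ℕ, T3Thm1Carrier.Idx L → Prop)
    (hT₁ : ∀ (L : ℕ), 1 < L → ∀ (i : T3Thm1Carrier.Idx L) (U₀ : GaugeField (i.1.1.P i.1.2.2) 0 (Matrix.specialUnitaryGroup (Fin 2) ℂ)), Large L i →
      RegPr i.1.1 i.1.2.1 i.1.2.2 (α₁ L) U₀ →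
      ∀ (Q'' : SiteL2K ℂ 3 (periodsT3 i.1.1 i.1.2.2) (c₀ L) W₂ →ₗ[ℂ] (Site (i.1.1.P i.1.2.2) (i.1.2.2 - i.1.2.1) → Matrix (Fin 2) (Fin 2) ℂ)),
        (∀ (lam : Site (i.1.1.P i.1.2.2) 0 → Matrix (Fin 2) (Fin 2) ℂ) (ns : (j : ℕ) → Site (i.1.1.P i.1.2.2) j → Matrix (Fin 2) (Fin 2) ℂ), ns 0 = lam →
          (∀ (j : ℕ) (y : Site (i.1.1.P i.1.2.2) (j + 1)),
            ns (j + 1) y = ns j (emb y) - meanCLM (Idx (i.1.1.P i.1.2.2)) (Matrix (Fin 2) (Fin 2) ℂ)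
            fun ι : Idx (i.1.1.P i.1.2.2) =>
            ns j (emb y) - ((holT (emlIterU j (bgUnits i.1.1 i.1.2.2 U₀)) (emb y) (stairWord ι.2.1 (off ι.1)) : (Matrix (Fin 2) (Fin 2) ℂ)ˣ) : Matrix (Fin 2) (Fin 2) ℂ) *
              ns j (transl (emb y) (disp (stairWord ι.2.1 (off ι.1)))) *
              (((holT (emlIterU j (bgUnits i.1.1 i.1.2.2 U₀)) (emb y) (stairWord ι.2.1 (off ι.1)))⁻¹ : (Matrix (Fin 2) (Fin 2) ℂ)ˣ) : Matrix (Fin 2) (Fin 2) ℂ)) →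
          ns (i.1.2.2 - i.1.2.1) = Q'' (toL2S i.1.1 i.1.2.2 (c₀ L) lam)) →
        LinearMap.ker Q'' ≤ NS i.1.1 i.1.2.1 i.1.2.2 i.2.2.le (c₀ L) (cB L) U₀ →
        ∀ A : BondL2K ℂ 3 (periodsT3 i.1.1 i.1.2.2) (c₀ L) W₂, γ₁ L * ‖A‖ ^ 2 ≤
          RCLike.re ⟪A, DeltaEta i.1.1 i.1.2.1 i.1.2.2 (c₀ L) U₀ A⟫_ℂ
            + ‖projR (covLapSite i.1.1 i.1.2.1 i.1.2.2 (c₀ L) U₀) Q'' (DstarL2 i.1.1 i.1.2.1 i.1.2.2 (c₀ L) U₀ A)‖ ^ 2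
            + a₁ L i * ‖Qk i.1.1 i.1.2.1 i.1.2.2 i.2.2.le (c₀ L) (cB L) U₀ A‖ ^ 2)
    (hT₂ : ∀ (L : ℕ), 1 < L → ∀ (i : T3Thm1Carrier.Idx L) (U₀ : GaugeField (i.1.1.P i.1.2.2) 0 (Matrix.specialUnitaryGroup (Fin 2) ℂ)), ¬ Large L i →
      RegPr i.1.1 i.1.2.1 i.1.2.2 (α₂ L) U₀ →
      ∀ (Q'' : SiteL2K ℂ 3 (periodsT3 i.1.1 i.1.2.2) (c₀ L) W₂ →ₗ[ℂ] (Site (i.1.1.P i.1.2.2) (i.1.2.2 - i.1.2.1) → Matrix (Fin 2) (Fin 2) ℂ)),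
        (∀ (lam : Site (i.1.1.P i.1.2.2) 0 → Matrix (Fin 2) (Fin 2) ℂ) (ns : (j : ℕ) → Site (i.1.1.P i.1.2.2) j → Matrix (Fin 2) (Fin 2) ℂ), ns 0 = lam →
          (∀ (j : ℕ) (y : Site (i.1.1.P i.1.2.2) (j + 1)),
            ns (j + 1) y = ns j (emb y) - meanCLM (Idx (i.1.1.P i.1.2.2)) (Matrix (Fin 2) (Fin 2) ℂ)
            fun ι : Idx (i.1.1.P i.1.2.2) =>
            ns j (emb y) - ((holT (emlIterU j (bgUnits i.1.1 i.1.2.2 U₀)) (emb y) (stairWord ι.2.1 (off ι.1)) : (Matrix (Fin 2) (Fin 2) ℂ)ˣ) : Matrix (Fin 2) (Fin 2) ℂ) *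
              ns j (transl (emb y) (disp (stairWord ι.2.1 (off ι.1)))) *
              (((holT (emlIterU j (bgUnits i.1.1 i.1.2.2 U₀)) (emb y) (stairWord ι.2.1 (off ι.1)))⁻¹ : (Matrix (Fin 2) (Fin 2) ℂ)ˣ) : Matrix (Fin 2) (Fin 2) ℂ)) →
          ns (i.1.2.2 - i.1.2.1) = Q'' (toL2S i.1.1 i.1.2.2 (c₀ L) lam)) →
        LinearMap.ker Q'' ≤ NS i.1.1 i.1.2.1 i.1.2.2 i.2.2.le (c₀ L) (cB L) U₀ →
        ∀ A : BondL2K ℂ 3 (periodsT3 i.1.1 i.1.2.2) (c₀ L) W₂, γ₂ L * ‖A‖ ^ 2 ≤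
          RCLike.re ⟪A, DeltaEta i.1.1 i.1.2.1 i.1.2.2 (c₀ L) U₀ A⟫_ℂ
            + ‖projR (covLapSite i.1.1 i.1.2.1 i.1.2.2 (c₀ L) U₀) Q'' (DstarL2 i.1.1 i.1.2.1 i.1.2.2 (c₀ L) U₀ A)‖ ^ 2
            + a₂ L i * ‖Qk i.1.1 i.1.2.1 i.1.2.2 i.2.2.le (c₀ L) (cB L) U₀ A‖ ^ 2) :
    ∀ (L : ℕ), 1 < L → ∀ (i : T3Thm1Carrier.Idx L) (U₀ : GaugeField (i.1.1.P i.1.2.2) 0 (Matrix.specialUnitaryGroup (Fin 2) ℂ)), ∀ ρ : ℝ,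
      RegPr i.1.1 i.1.2.1 i.1.2.2 ρ U₀ → ρ ≤ min (α₁ L) (α₂ L) →
      (∀ cf : Site (i.1.1.P i.1.2.2) (i.1.2.2 - i.1.2.1) → Matrix (Fin 2) (Fin 2) ℂ,
        (∀ e' : PBond (i.1.1.P i.1.2.2) (i.1.2.2 - i.1.2.1),
          cf e'.src = ((emlIterU (i.1.2.2 - i.1.2.1) (bgUnits i.1.1 i.1.2.2 U₀) e' : (Matrix (Fin 2) (Fin 2) ℂ)ˣ) : Matrix (Fin 2) (Fin 2) ℂ) * cf e'.tgt *
          (((emlIterU (i.1.2.2 - i.1.2.1) (bgUnits i.1.1 i.1.2.2 U₀) e')⁻¹ : (Matrix (Fin 2) (Fin 2) ℂ)ˣ) : Matrix (Fin 2) (Fin 2) ℂ)) →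
        ∃ l₀ : Site (i.1.1.P i.1.2.2) 0 → Matrix (Fin 2) (Fin 2) ℂ,
        (∀ b' : PBond (i.1.1.P i.1.2.2) 0, l₀ b'.src = ((bgUnits i.1.1 i.1.2.2 U₀ b' : (Matrix (Fin 2) (Fin 2) ℂ)ˣ) : Matrix (Fin 2) (Fin 2) ℂ) * l₀ b'.tgt *
          (((bgUnits i.1.1 i.1.2.2 U₀ b')⁻¹ : (Matrix (Fin 2) (Fin 2) ℂ)ˣ) : Matrix (Fin 2) (Fin 2) ℂ)) ∧
        ∀ y : Site (i.1.1.P i.1.2.2) (i.1.2.2 - i.1.2.1), l₀ (embIter (i.1.2.2 - i.1.2.1) y) = cf y) →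
      ∀ A : BondL2K ℂ 3 (periodsT3 i.1.1 i.1.2.2) (c₀ L) W₂,
        RS i.1.1 i.1.2.1 i.1.2.2 i.2.2.le (c₀ L) (cB L) U₀ (DstarL2 i.1.1 i.1.2.1 i.1.2.2 (c₀ L) U₀ A) = 0 → min (γ₁ L) (γ₂ L) * ‖A‖ ^ 2 ≤
          RCLike.re ⟪A, DeltaEta i.1.1 i.1.2.1 i.1.2.2 (c₀ L) U₀ A⟫_ℂ + a L i * ‖Qk i.1.1 i.1.2.1 i.1.2.2 i.2.2.le (c₀ L) (cB L) U₀ A‖ ^ 2 := by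
  classical
  refine gaugeFixedRow_idx_of_curvedTarget_of_le_coupling (fun L => min (α₁ L) (α₂ L)) (fun L hL => lt_min (hα₁ L hL) (hα₂ L hL))
    (fun L hL => (mul_le_mul_of_nonneg_left (min_le_left _ _) (by positivity)).trans (hWα L hL)) c₀ cB
    (fun L i => if Large L i then a₁ L i else a₂ L i) a (fun L i => by
      by_cases hi : Large L i
      · rw [if_pos hi]; exact ha₁ L i
      · rw [if_neg hi]; exact ha₂ L i) (fun L => min (γ₁ L) (γ₂ L)) ?_
  intro L hL i U₀ hreg Q'' htop hker A
  have hA0 : 0 ≤ ‖A‖ ^ 2 := sq_nonneg _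
  by_cases hi : Large L i
  · rw [if_pos hi]
    have h1 := hT₁ L hL i U₀ hi (regPr_mono (F := i.1.1) (min_le_left _ _) hreg) Q'' htop hker A
    have h2 : min (γ₁ L) (γ₂ L) * ‖A‖ ^ 2 ≤ γ₁ L * ‖A‖ ^ 2 := mul_le_mul_of_nonneg_right (min_le_left _ _) hA0
    exact h2.trans h1
  · rw [if_neg hi]
    have h1 := hT₂ L hL i U₀ hi (regPr_mono (F := i.1.1) (min_le_right _ _) hreg) Q'' htop hker A
    have h2 : min (γ₁ L) (γ₂ L) * ‖A‖ ^ 2 ≤ γ₂ L * ‖A‖ ^ 2 := mul_le_mul_of_nonneg_right (min_le_right _ _) hA0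
    exact h2.trans h1

/-! ## §2 The reading at the cube-scale threshold `s₀(L)` -/

/-- ★★ **THE TWO-REGIME DOOR AT THE CUBE-SCALE THRESHOLD.**  `s₀ : ℕ → ℕ` (the §2-window scale of the (L6) LOD member assembly): LARGE members
`s₀ L < m + n` (an admissible cube scale `s₀ L` exists — ✓`Prop7LODCutoffDock.exists_LOD_cutoffs_corner`'s `hs : s < F.m + n`) carry the LOD target `hT₁`; SMALL members
`m + n ≤ s₀ L` carry the toron∕twisted-Plancherel target `hT₂` ((α)(a), ★★OWNER WORDS 79∕82); conclusion = the `hGF` binder of S44ᴸγ at `αcap := min α₁ α₂`, `γ := min γ₁ γ₂`.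
[cite: Balaban1985BackgroundPropagators, Thm 3.3 p.398, Thm 3.11 p.416; Balaban1984PropagatorsI, Prop. 1.1 (1.90) p.33] -/
theorem gaugeFixedRow_idx_of_curvedTargets_cubeScale (α₁ α₂ : ℕ → ℝ) (hα₁ : ∀ L : ℕ, 1 < L → 0 < α₁ L) (hα₂ : ∀ L : ℕ, 1 < L → 0 < α₂ L)
    (hWα : ∀ L : ℕ, 1 < L → 10 ^ 12 * (L : ℝ) ^ 3 * α₁ L ≤ 1)
    (c₀ cB : ℕ → ℝ) [hc₀ : ∀ L : ℕ, Fact (0 < c₀ L)] [hcB : ∀ L : ℕ, Fact (0 < cB L)] (a₁ a₂ a : ∀ L : ℕ, T3Thm1Carrier.Idx L → ℝ)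
    (ha₁ : ∀ (L : ℕ) (i : T3Thm1Carrier.Idx L), a₁ L i ≤ a L i) (ha₂ : ∀ (L : ℕ) (i : T3Thm1Carrier.Idx L), a₂ L i ≤ a L i) (γ₁ γ₂ : ℕ → ℝ)
    (s₀ : ℕ → ℕ)
    (hT₁ : ∀ (L : ℕ), 1 < L → ∀ (i : T3Thm1Carrier.Idx L) (U₀ : GaugeField (i.1.1.P i.1.2.2) 0 (Matrix.specialUnitaryGroup (Fin 2) ℂ)), s₀ L < i.1.1.m + i.1.2.1 →
      RegPr i.1.1 i.1.2.1 i.1.2.2 (α₁ L) U₀ →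
      ∀ (Q'' : SiteL2K ℂ 3 (periodsT3 i.1.1 i.1.2.2) (c₀ L) W₂ →ₗ[ℂ] (Site (i.1.1.P i.1.2.2) (i.1.2.2 - i.1.2.1) → Matrix (Fin 2) (Fin 2) ℂ)),
        (∀ (lam : Site (i.1.1.P i.1.2.2) 0 → Matrix (Fin 2) (Fin 2) ℂ) (ns : (j : ℕ) → Site (i.1.1.P i.1.2.2) j → Matrix (Fin 2) (Fin 2) ℂ), ns 0 = lam →
          (∀ (j : ℕ) (y : Site (i.1.1.P i.1.2.2) (j + 1)),
            ns (j + 1) y = ns j (emb y) - meanCLM (Idx (i.1.1.P i.1.2.2)) (Matrix (Fin 2) (Fin 2) ℂ)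
            fun ι : Idx (i.1.1.P i.1.2.2) =>
            ns j (emb y) - ((holT (emlIterU j (bgUnits i.1.1 i.1.2.2 U₀)) (emb y) (stairWord ι.2.1 (off ι.1)) : (Matrix (Fin 2) (Fin 2) ℂ)ˣ) : Matrix (Fin 2) (Fin 2) ℂ) *
              ns j (transl (emb y) (disp (stairWord ι.2.1 (off ι.1)))) *
              (((holT (emlIterU j (bgUnits i.1.1 i.1.2.2 U₀)) (emb y) (stairWord ι.2.1 (off ι.1)))⁻¹ : (Matrix (Fin 2) (Fin 2) ℂ)ˣ) : Matrix (Fin 2) (Fin 2) ℂ)) →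
          ns (i.1.2.2 - i.1.2.1) = Q'' (toL2S i.1.1 i.1.2.2 (c₀ L) lam)) →
        LinearMap.ker Q'' ≤ NS i.1.1 i.1.2.1 i.1.2.2 i.2.2.le (c₀ L) (cB L) U₀ →
        ∀ A : BondL2K ℂ 3 (periodsT3 i.1.1 i.1.2.2) (c₀ L) W₂, γ₁ L * ‖A‖ ^ 2 ≤
          RCLike.re ⟪A, DeltaEta i.1.1 i.1.2.1 i.1.2.2 (c₀ L) U₀ A⟫_ℂ
            + ‖projR (covLapSite i.1.1 i.1.2.1 i.1.2.2 (c₀ L) U₀) Q'' (DstarL2 i.1.1 i.1.2.1 i.1.2.2 (c₀ L) U₀ A)‖ ^ 2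
            + a₁ L i * ‖Qk i.1.1 i.1.2.1 i.1.2.2 i.2.2.le (c₀ L) (cB L) U₀ A‖ ^ 2)
    (hT₂ : ∀ (L : ℕ), 1 < L → ∀ (i : T3Thm1Carrier.Idx L) (U₀ : GaugeField (i.1.1.P i.1.2.2) 0 (Matrix.specialUnitaryGroup (Fin 2) ℂ)), i.1.1.m + i.1.2.1 ≤ s₀ L →
      RegPr i.1.1 i.1.2.1 i.1.2.2 (α₂ L) U₀ →
      ∀ (Q'' : SiteL2K ℂ 3 (periodsT3 i.1.1 i.1.2.2) (c₀ L) W₂ →ₗ[ℂ] (Site (i.1.1.P i.1.2.2) (i.1.2.2 - i.1.2.1) → Matrix (Fin 2) (Fin 2) ℂ)),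
        (∀ (lam : Site (i.1.1.P i.1.2.2) 0 → Matrix (Fin 2) (Fin 2) ℂ) (ns : (j : ℕ) → Site (i.1.1.P i.1.2.2) j → Matrix (Fin 2) (Fin 2) ℂ), ns 0 = lam →
          (∀ (j : ℕ) (y : Site (i.1.1.P i.1.2.2) (j + 1)),
            ns (j + 1) y = ns j (emb y) - meanCLM (Idx (i.1.1.P i.1.2.2)) (Matrix (Fin 2) (Fin 2) ℂ)
            fun ι : Idx (i.1.1.P i.1.2.2) =>
            ns j (emb y) - ((holT (emlIterU j (bgUnits i.1.1 i.1.2.2 U₀)) (emb y) (stairWord ι.2.1 (off ι.1)) : (Matrix (Fin 2) (Fin 2) ℂ)ˣ) : Matrix (Fin 2) (Fin 2) ℂ) *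
              ns j (transl (emb y) (disp (stairWord ι.2.1 (off ι.1)))) *
              (((holT (emlIterU j (bgUnits i.1.1 i.1.2.2 U₀)) (emb y) (stairWord ι.2.1 (off ι.1)))⁻¹ : (Matrix (Fin 2) (Fin 2) ℂ)ˣ) : Matrix (Fin 2) (Fin 2) ℂ)) →
          ns (i.1.2.2 - i.1.2.1) = Q'' (toL2S i.1.1 i.1.2.2 (c₀ L) lam)) →
        LinearMap.ker Q'' ≤ NS i.1.1 i.1.2.1 i.1.2.2 i.2.2.le (c₀ L) (cB L) U₀ →
        ∀ A : BondL2K ℂ 3 (periodsT3 i.1.1 i.1.2.2) (c₀ L) W₂, γ₂ L * ‖A‖ ^ 2 ≤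
          RCLike.re ⟪A, DeltaEta i.1.1 i.1.2.1 i.1.2.2 (c₀ L) U₀ A⟫_ℂ
            + ‖projR (covLapSite i.1.1 i.1.2.1 i.1.2.2 (c₀ L) U₀) Q'' (DstarL2 i.1.1 i.1.2.1 i.1.2.2 (c₀ L) U₀ A)‖ ^ 2
            + a₂ L i * ‖Qk i.1.1 i.1.2.1 i.1.2.2 i.2.2.le (c₀ L) (cB L) U₀ A‖ ^ 2) :
    ∀ (L : ℕ), 1 < L → ∀ (i : T3Thm1Carrier.Idx L) (U₀ : GaugeField (i.1.1.P i.1.2.2) 0 (Matrix.specialUnitaryGroup (Fin 2) ℂ)), ∀ ρ : ℝ,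
      RegPr i.1.1 i.1.2.1 i.1.2.2 ρ U₀ → ρ ≤ min (α₁ L) (α₂ L) →
      (∀ cf : Site (i.1.1.P i.1.2.2) (i.1.2.2 - i.1.2.1) → Matrix (Fin 2) (Fin 2) ℂ,
        (∀ e' : PBond (i.1.1.P i.1.2.2) (i.1.2.2 - i.1.2.1),
          cf e'.src = ((emlIterU (i.1.2.2 - i.1.2.1) (bgUnits i.1.1 i.1.2.2 U₀) e' : (Matrix (Fin 2) (Fin 2) ℂ)ˣ) : Matrix (Fin 2) (Fin 2) ℂ) * cf e'.tgt *
          (((emlIterU (i.1.2.2 - i.1.2.1) (bgUnits i.1.1 i.1.2.2 U₀) e')⁻¹ : (Matrix (Fin 2) (Fin 2) ℂ)ˣ) : Matrix (Fin 2) (Fin 2) ℂ)) →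
        ∃ l₀ : Site (i.1.1.P i.1.2.2) 0 → Matrix (Fin 2) (Fin 2) ℂ,
        (∀ b' : PBond (i.1.1.P i.1.2.2) 0, l₀ b'.src = ((bgUnits i.1.1 i.1.2.2 U₀ b' : (Matrix (Fin 2) (Fin 2) ℂ)ˣ) : Matrix (Fin 2) (Fin 2) ℂ) * l₀ b'.tgt *
          (((bgUnits i.1.1 i.1.2.2 U₀ b')⁻¹ : (Matrix (Fin 2) (Fin 2) ℂ)ˣ) : Matrix (Fin 2) (Fin 2) ℂ)) ∧
        ∀ y : Site (i.1.1.P i.1.2.2) (i.1.2.2 - i.1.2.1), l₀ (embIter (i.1.2.2 - i.1.2.1) y) = cf y) →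
      ∀ A : BondL2K ℂ 3 (periodsT3 i.1.1 i.1.2.2) (c₀ L) W₂,
        RS i.1.1 i.1.2.1 i.1.2.2 i.2.2.le (c₀ L) (cB L) U₀ (DstarL2 i.1.1 i.1.2.1 i.1.2.2 (c₀ L) U₀ A) = 0 → min (γ₁ L) (γ₂ L) * ‖A‖ ^ 2 ≤
          RCLike.re ⟪A, DeltaEta i.1.1 i.1.2.1 i.1.2.2 (c₀ L) U₀ A⟫_ℂ + a L i * ‖Qk i.1.1 i.1.2.1 i.1.2.2 i.2.2.le (c₀ L) (cB L) U₀ A‖ ^ 2 :=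
  gaugeFixedRow_idx_of_curvedTargets_split α₁ α₂ hα₁ hα₂ hWα c₀ cB a₁ a₂ a ha₁ ha₂ γ₁ γ₂ (fun L i => s₀ L < i.1.1.m + i.1.2.1)
    (fun L hL i U₀ hi => hT₁ L hL i U₀ hi) (fun L hL i U₀ hi => hT₂ L hL i U₀ (not_lt.mp hi))

end Summit.QuantumFields.YangMills.Theorems.Prop7GaugeFixedRowDoorTwoRegime

end
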